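import Summits.Ventures.Crystal3D.Theorems.StickyWulffConstantPolycrystalWulffBoundGenericShiftShells
import Summits.Ventures.Crystal3D.Theorems.StickyWulffConstantPolycrystalWulffBoundGenericShiftGrid

/-!
# `PolycrystalWulffBound`, line `PolyDensity`: the GENERIC SHIFT LEMMA at `θ = 3/5` — across a wall
# between two ARBITRARY lattices the cdf shift is at most `3/5` (crux `stmt-Ventures-19482`; decision
# thread L-2 «generic-charge relaxation» of cf-p1 §87.0)

Route `StickyWulffConstant` of the venture `Summits/Ventures/Crystal3D`, second prover lane (poly-p2,
gen 15).  Gen 14 landed `cruxWulffBody_cap_shift_one` (`θ = 1`, what the law `c₀ = 1` needs).  This file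
proves, for EVERY pair of frames `A, B`, every unit normal `n` and every level `s`,

  `|W(A) ∩ {s + 3/5 < ⟪y,n⟫}| ≤ |W(B) ∩ {s < ⟪y,n⟫}|`      (`cruxWulffBody_cap_shift_three_fifths`),

so the gap-sorted engine (`rung_gapTree(_law)`, `rung_gapCells`) can pay every generic wall at
`θ = 3/5` per unit area: on the P side the route is consistent with any generic charge `c₀ ≥ 3/5`.
INGREDIENTS, all rotation-invariant: the two-shell envelopes of the cap profile
(`volume_cruxWulffBody_cap_le_shell`, `volume_cruxWulffBody_cap_ge_shell` — inner ball `B̄(0,√3)`,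
shell to radius `2` with the lower mass bound `π(20√3 − 32)`, remainder of mass `≤ 32 − π(24√3−32)`,
central symmetry), the ball caps of `B̄(0,√3) ⊆ W ⊆ B̄(0,√5)`, the median `16`, and a MONOTONE GRID:
both sides are non-increasing in the level, so the thirteen numerical facts of `…GenericShiftGrid`
(`upper(aᵢ + 3/5) ≤ lower(aᵢ₊₁)` on `0, .371, …, 1.585, 1.6361`) give the inequality on each
`[aᵢ, aᵢ₊₁]` (`cruxWulffBody_cap_shift_of_bounds`); `s ≥ 1.6361 > √5 − 3/5` is an empty cap,
`s ∈ [−3/10, 0]` goes through the median, and `s < −3/10` follows by complements with the frames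
swapped.  NUMBERS (memo P-L2-g15): two-shell envelopes certify `0.558` (grid slack ≥ 0.012 at `0.6`),
three shells `0.520`, 33 shells `0.507`; the sharp value is the wetting threshold `√5 − √3 = 0.50402`
(support gap, needed only for vanishing satellites); for `2 ≤ 32u ≤ 30` the true directional spread is
`≤ 0.0674`.
WHAT THIS IS NOT: the sharp constant; a statement about co-axial pairs; the crux is not claimed.
-/

noncomputable section

open scoped BigOperators InnerProductSpace ENNReal Pointwise
open MeasureTheory Set

namespace Summit.Ventures.Crystal3D.Theorems

open Summit.Ventures.Crystal3D.Cruxes.TextureLiminf.TexShadow (E3)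

open Literature.MathematicalPhysics.StatisticalMechanics (fccStacking)

/-! ### One grid step: monotonicity of both profiles -/

/-- A grid step: if `a ≤ s ≤ b`, `a_A(a + 3/5) ≤ u ≤ l ≤ a_B(b)` then `a_A(s + 3/5) ≤ a_B(s)`
(both cap profiles are non-increasing in the level). -/
theorem cruxWulffBody_cap_shift_of_bounds (A B : E3 ≃ₗᵢ[ℝ] E3) (n : E3) {s a b u l : ℝ}
    (ha : a ≤ s) (hb : s ≤ b)
    (hU : volume ({y : E3 | ∀ ν : E3, ⟪y, ν⟫_ℝ ≤ Real.sqrt 2 / 4 *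
        ∑ᶠ w ∈ {w | w ∈ fccStacking 1 (Real.sqrt (2 / 3)) ∧ ‖w‖ = 1}, |⟪w, A.symm ν⟫_ℝ|} ∩
        {y : E3 | a + 3 / 5 < ⟪y, n⟫_ℝ}) ≤ ENNReal.ofReal u)
    (hul : u ≤ l)
    (hL : ENNReal.ofReal l ≤ volume ({y : E3 | ∀ ν : E3, ⟪y, ν⟫_ℝ ≤ Real.sqrt 2 / 4 *
        ∑ᶠ w ∈ {w | w ∈ fccStacking 1 (Real.sqrt (2 / 3)) ∧ ‖w‖ = 1}, |⟪w, B.symm ν⟫_ℝ|} ∩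
        {y : E3 | b < ⟪y, n⟫_ℝ})) :
    volume ({y : E3 | ∀ ν : E3, ⟪y, ν⟫_ℝ ≤ Real.sqrt 2 / 4 *
        ∑ᶠ w ∈ {w | w ∈ fccStacking 1 (Real.sqrt (2 / 3)) ∧ ‖w‖ = 1}, |⟪w, A.symm ν⟫_ℝ|} ∩
        {y : E3 | s + 3 / 5 < ⟪y, n⟫_ℝ}) ≤
      volume ({y : E3 | ∀ ν : E3, ⟪y, ν⟫_ℝ ≤ Real.sqrt 2 / 4 *
        ∑ᶠ w ∈ {w | w ∈ fccStacking 1 (Real.sqrt (2 / 3)) ∧ ‖w‖ = 1}, |⟪w, B.symm ν⟫_ℝ|} ∩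
        {y : E3 | s < ⟪y, n⟫_ℝ}) := by
  calc volume ({y : E3 | ∀ ν : E3, ⟪y, ν⟫_ℝ ≤ Real.sqrt 2 / 4 *
        ∑ᶠ w ∈ {w | w ∈ fccStacking 1 (Real.sqrt (2 / 3)) ∧ ‖w‖ = 1}, |⟪w, A.symm ν⟫_ℝ|} ∩
        {y : E3 | s + 3 / 5 < ⟪y, n⟫_ℝ})
      ≤ volume ({y : E3 | ∀ ν : E3, ⟪y, ν⟫_ℝ ≤ Real.sqrt 2 / 4 *
        ∑ᶠ w ∈ {w | w ∈ fccStacking 1 (Real.sqrt (2 / 3)) ∧ ‖w‖ = 1}, |⟪w, A.symm ν⟫_ℝ|} ∩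
        {y : E3 | a + 3 / 5 < ⟪y, n⟫_ℝ}) :=
        measure_mono (inter_subset_inter_right _ fun y (hy : s + 3 / 5 < ⟪y, n⟫_ℝ) => by
          show a + 3 / 5 < ⟪y, n⟫_ℝ; linarith)
    _ ≤ ENNReal.ofReal u := hU
    _ ≤ ENNReal.ofReal l := ENNReal.ofReal_le_ofReal hul
    _ ≤ volume ({y : E3 | ∀ ν : E3, ⟪y, ν⟫_ℝ ≤ Real.sqrt 2 / 4 *
        ∑ᶠ w ∈ {w | w ∈ fccStacking 1 (Real.sqrt (2 / 3)) ∧ ‖w‖ = 1}, |⟪w, B.symm ν⟫_ℝ|} ∩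
        {y : E3 | b < ⟪y, n⟫_ℝ}) := hL
    _ ≤ volume ({y : E3 | ∀ ν : E3, ⟪y, ν⟫_ℝ ≤ Real.sqrt 2 / 4 *
        ∑ᶠ w ∈ {w | w ∈ fccStacking 1 (Real.sqrt (2 / 3)) ∧ ‖w‖ = 1}, |⟪w, B.symm ν⟫_ℝ|} ∩
        {y : E3 | s < ⟪y, n⟫_ℝ}) :=
        measure_mono (inter_subset_inter_right _ fun y (hy : b < ⟪y, n⟫_ℝ) => by
          show s < ⟪y, n⟫_ℝ; linarith)

/-! ### The generic shift lemma at `θ = 3/5` -/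

/-- **Generic cdf shift ≤ 3/5, the half-line `s ≥ −3/10`** (empty cap above `√5`, the median for
`s ∈ [−3/10, 0]`, and the twelve grid steps on `[0, 1.6361]`). -/
theorem cruxWulffBody_cap_shift_three_fifths_of_ge (A B : E3 ≃ₗᵢ[ℝ] E3) {n : E3} (hn : ‖n‖ = 1)
    {s : ℝ} (hs : -3 / 10 ≤ s) :
    volume ({y : E3 | ∀ ν : E3, ⟪y, ν⟫_ℝ ≤ Real.sqrt 2 / 4 *
        ∑ᶠ w ∈ {w | w ∈ fccStacking 1 (Real.sqrt (2 / 3)) ∧ ‖w‖ = 1}, |⟪w, A.symm ν⟫_ℝ|} ∩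
        {y : E3 | s + 3 / 5 < ⟪y, n⟫_ℝ}) ≤
      volume ({y : E3 | ∀ ν : E3, ⟪y, ν⟫_ℝ ≤ Real.sqrt 2 / 4 *
        ∑ᶠ w ∈ {w | w ∈ fccStacking 1 (Real.sqrt (2 / 3)) ∧ ‖w‖ = 1}, |⟪w, B.symm ν⟫_ℝ|} ∩
        {y : E3 | s < ⟪y, n⟫_ℝ}) := by
  set WA : Set E3 := {y : E3 | ∀ ν : E3, ⟪y, ν⟫_ℝ ≤ Real.sqrt 2 / 4 *
        ∑ᶠ w ∈ {w | w ∈ fccStacking 1 (Real.sqrt (2 / 3)) ∧ ‖w‖ = 1}, |⟪w, A.symm ν⟫_ℝ|} with hWA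
  set WB : Set E3 := {y : E3 | ∀ ν : E3, ⟪y, ν⟫_ℝ ≤ Real.sqrt 2 / 4 *
        ∑ᶠ w ∈ {w | w ∈ fccStacking 1 (Real.sqrt (2 / 3)) ∧ ‖w‖ = 1}, |⟪w, B.symm ν⟫_ℝ|} with hWB
  obtain ⟨h3lo, h3hi, h5lo, h5hi, -, -, -, -, -, -, -, -⟩ := shift_grid_constants
  have h5pos : 0 < Real.sqrt 5 := Real.sqrt_pos.2 (by norm_num)
  have h3pos : 0 < Real.sqrt 3 := Real.sqrt_pos.2 (by norm_num)
  by_cases htop : (1.6361 : ℝ) ≤ s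
  · -- the `A`-cap is empty: `s + 3/5 > √5`
    have hempty : WA ∩ {y : E3 | s + 3 / 5 < ⟪y, n⟫_ℝ} = ∅ := by
      ext y
      simp only [mem_inter_iff, mem_setOf_eq, mem_empty_iff_false, iff_false, not_and, not_lt]
      intro hy
      have hy5 : ‖y‖ ≤ Real.sqrt 5 := mem_closedBall_zero_iff.1 (cruxWulffBody_subset_closedBall A hy)
      have h1 : ⟪y, n⟫_ℝ ≤ ‖y‖ * ‖n‖ := real_inner_le_norm _ _
      rw [hn, mul_one] at h1
      linarith
    rw [hempty, measure_empty]
    exact bot_le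
  rw [not_le] at htop
  by_cases h0 : s < 0
  · -- medians: `a_A(s + 3/5) ≤ upper₁(3/10) ≤ 16 = a_B(0) ≤ a_B(s)`
    calc volume (WA ∩ {y : E3 | s + 3 / 5 < ⟪y, n⟫_ℝ})
        ≤ volume (WA ∩ {y : E3 | (3 : ℝ) / 10 < ⟪y, n⟫_ℝ}) :=
          measure_mono (inter_subset_inter_right _ fun y (hy : s + 3 / 5 < ⟪y, n⟫_ℝ) => by
            show (3 : ℝ) / 10 < ⟪y, n⟫_ℝ; linarith)
      _ ≤ ENNReal.ofReal (Real.pi * (16 / 3 - 4 * ((3 : ℝ) / 10) + ((3 : ℝ) / 10) ^ 3 / 3) +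
            (16 + 16 * Real.pi - 12 * Real.pi * Real.sqrt 3)) :=
          volume_cruxWulffBody_cap_le_shell A hn (q := (3 : ℝ) / 10) (by norm_num) (by norm_num)
      _ ≤ ENNReal.ofReal 16 := ENNReal.ofReal_le_ofReal shift_grid_median
      _ = volume (WB ∩ {y : E3 | 0 < ⟪y, n⟫_ℝ}) := (volume_cruxWulffBody_cap_zero B hn).symm
      _ ≤ volume (WB ∩ {y : E3 | s < ⟪y, n⟫_ℝ}) :=
          measure_mono (inter_subset_inter_right _ fun y (hy : 0 < ⟪y, n⟫_ℝ) => by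
            show s < ⟪y, n⟫_ℝ; linarith)
  rw [not_lt] at h0
  -- locate `s` in the grid `0, .371, …, 1.585, 1.6361`
  by_cases hc1 : s ≤ (0.371 : ℝ)
  · exact cruxWulffBody_cap_shift_of_bounds A B n h0 hc1
      (volume_cruxWulffBody_cap_le_shell A hn (q := ((0 : ℝ) + 3 / 5)) (by norm_num) (by norm_num))
      shift_grid_1
      (volume_cruxWulffBody_cap_ge_shell B hn (q := (0.371 : ℝ)) (by norm_num) (by linarith))
  by_cases hc2 : s ≤ (0.709 : ℝ)
  · exact cruxWulffBody_cap_shift_of_bounds A B n (le_of_lt (not_le.1 hc1)) hc2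
      (volume_cruxWulffBody_cap_le_shell A hn (q := ((0.371 : ℝ) + 3 / 5)) (by norm_num) (by norm_num))
      shift_grid_2
      (volume_cruxWulffBody_cap_ge_shell B hn (q := (0.709 : ℝ)) (by norm_num) (by linarith))
  by_cases hc3 : s ≤ (0.986 : ℝ)
  · exact cruxWulffBody_cap_shift_of_bounds A B n (le_of_lt (not_le.1 hc2)) hc3
      (volume_cruxWulffBody_cap_le_shell A hn (q := ((0.709 : ℝ) + 3 / 5)) (by norm_num) (by norm_num))
      shift_grid_3
      (volume_cruxWulffBody_cap_ge_shell B hn (q := (0.986 : ℝ)) (by norm_num) (by linarith))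
  by_cases hc4 : s ≤ (1.172 : ℝ)
  · exact cruxWulffBody_cap_shift_of_bounds A B n (le_of_lt (not_le.1 hc3)) hc4
      (volume_cruxWulffBody_cap_le_shell A hn (q := ((0.986 : ℝ) + 3 / 5)) (by norm_num) (by norm_num))
      shift_grid_4
      (volume_cruxWulffBody_cap_ge_shell B hn (q := (1.172 : ℝ)) (by norm_num) (by linarith))
  by_cases hc5 : s ≤ (1.259 : ℝ)
  · exact cruxWulffBody_cap_shift_of_bounds A B n (le_of_lt (not_le.1 hc4)) hc5
      (volume_cruxWulffBody_cap_le_shell A hn (q := ((1.172 : ℝ) + 3 / 5)) (by norm_num) (by norm_num))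
      shift_grid_5
      (volume_cruxWulffBody_cap_ge_shell B hn (q := (1.259 : ℝ)) (by norm_num) (by linarith))
  by_cases hc6 : s ≤ (1.305 : ℝ)
  · exact cruxWulffBody_cap_shift_of_bounds A B n (le_of_lt (not_le.1 hc5)) hc6
      ((volume_cruxWulffBody_cap_le_ball A n ((1.259 : ℝ) + 3 / 5)).trans (le_of_eq
        (volume_closedBall_inter_ioi hn h5pos (by linarith) (by linarith))))
      shift_grid_6
      (volume_cruxWulffBody_cap_ge_shell B hn (q := (1.305 : ℝ)) (by norm_num) (by linarith))
  by_cases hc7 : s ≤ (1.347 : ℝ)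
  · exact cruxWulffBody_cap_shift_of_bounds A B n (le_of_lt (not_le.1 hc6)) hc7
      ((volume_cruxWulffBody_cap_le_ball A n ((1.305 : ℝ) + 3 / 5)).trans (le_of_eq
        (volume_closedBall_inter_ioi hn h5pos (by linarith) (by linarith))))
      shift_grid_7
      ((le_of_eq (volume_closedBall_inter_ioi hn h3pos (by linarith) (by linarith)).symm).trans
        (volume_ball_cap_le_cruxWulffBody B n (1.347 : ℝ)))
  by_cases hc8 : s ≤ (1.396 : ℝ)
  · exact cruxWulffBody_cap_shift_of_bounds A B n (le_of_lt (not_le.1 hc7)) hc8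
      ((volume_cruxWulffBody_cap_le_ball A n ((1.347 : ℝ) + 3 / 5)).trans (le_of_eq
        (volume_closedBall_inter_ioi hn h5pos (by linarith) (by linarith))))
      shift_grid_8
      ((le_of_eq (volume_closedBall_inter_ioi hn h3pos (by linarith) (by linarith)).symm).trans
        (volume_ball_cap_le_cruxWulffBody B n (1.396 : ℝ)))
  by_cases hc9 : s ≤ (1.452 : ℝ)
  · exact cruxWulffBody_cap_shift_of_bounds A B n (le_of_lt (not_le.1 hc8)) hc9
      ((volume_cruxWulffBody_cap_le_ball A n ((1.396 : ℝ) + 3 / 5)).trans (le_of_eq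
        (volume_closedBall_inter_ioi hn h5pos (by linarith) (by linarith))))
      shift_grid_9
      ((le_of_eq (volume_closedBall_inter_ioi hn h3pos (by linarith) (by linarith)).symm).trans
        (volume_ball_cap_le_cruxWulffBody B n (1.452 : ℝ)))
  by_cases hc10 : s ≤ (1.515 : ℝ)
  · exact cruxWulffBody_cap_shift_of_bounds A B n (le_of_lt (not_le.1 hc9)) hc10
      ((volume_cruxWulffBody_cap_le_ball A n ((1.452 : ℝ) + 3 / 5)).trans (le_of_eq
        (volume_closedBall_inter_ioi hn h5pos (by linarith) (by linarith))))
      shift_grid_10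
      ((le_of_eq (volume_closedBall_inter_ioi hn h3pos (by linarith) (by linarith)).symm).trans
        (volume_ball_cap_le_cruxWulffBody B n (1.515 : ℝ)))
  by_cases hc11 : s ≤ (1.585 : ℝ)
  · exact cruxWulffBody_cap_shift_of_bounds A B n (le_of_lt (not_le.1 hc10)) hc11
      ((volume_cruxWulffBody_cap_le_ball A n ((1.515 : ℝ) + 3 / 5)).trans (le_of_eq
        (volume_closedBall_inter_ioi hn h5pos (by linarith) (by linarith))))
      shift_grid_11
      ((le_of_eq (volume_closedBall_inter_ioi hn h3pos (by linarith) (by linarith)).symm).trans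
        (volume_ball_cap_le_cruxWulffBody B n (1.585 : ℝ)))
  exact cruxWulffBody_cap_shift_of_bounds A B n (le_of_lt (not_le.1 hc11)) htop.le
    ((volume_cruxWulffBody_cap_le_ball A n ((1.585 : ℝ) + 3 / 5)).trans (le_of_eq
        (volume_closedBall_inter_ioi hn h5pos (by linarith) (by linarith))))
    shift_grid_12
    ((le_of_eq (volume_closedBall_inter_ioi hn h3pos (by linarith) (by linarith)).symm).trans
        (volume_ball_cap_le_cruxWulffBody B n (1.6361 : ℝ)))

/-- **Generic cdf shift ≤ 3/5** (a uniform gap for a wall between two ARBITRARY lattices that the law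
can pay at any generic charge `c₀ ≥ 3/5`): for all frames `A, B`, unit `n` and `s`,
`|W(A) ∩ {s + 3/5 < ⟪y,n⟫}| ≤ |W(B) ∩ {s < ⟪y,n⟫}|`.  The half-line `s < −3/10` follows from
`s' = −s − 3/5 ≥ −3/10` with the frames swapped, by `a_X(τ) + a_X(−τ) = 32`. -/
theorem cruxWulffBody_cap_shift_three_fifths (A B : E3 ≃ₗᵢ[ℝ] E3) {n : E3} (hn : ‖n‖ = 1) (s : ℝ) :
    volume ({y : E3 | ∀ ν : E3, ⟪y, ν⟫_ℝ ≤ Real.sqrt 2 / 4 *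
        ∑ᶠ w ∈ {w | w ∈ fccStacking 1 (Real.sqrt (2 / 3)) ∧ ‖w‖ = 1}, |⟪w, A.symm ν⟫_ℝ|} ∩
        {y : E3 | s + 3 / 5 < ⟪y, n⟫_ℝ}) ≤
      volume ({y : E3 | ∀ ν : E3, ⟪y, ν⟫_ℝ ≤ Real.sqrt 2 / 4 *
        ∑ᶠ w ∈ {w | w ∈ fccStacking 1 (Real.sqrt (2 / 3)) ∧ ‖w‖ = 1}, |⟪w, B.symm ν⟫_ℝ|} ∩
        {y : E3 | s < ⟪y, n⟫_ℝ}) := by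
  by_cases hs : -3 / 10 ≤ s
  · exact cruxWulffBody_cap_shift_three_fifths_of_ge A B hn hs
  rw [not_le] at hs
  have hA := volume_cruxWulffBody_cap_add_cap_neg A hn (s + 3 / 5)
  have hB := volume_cruxWulffBody_cap_add_cap_neg B hn s
  have haux := cruxWulffBody_cap_shift_three_fifths_of_ge B A hn (s := -s - 3 / 5) (by linarith)
  have heq : -s - 3 / 5 + 3 / 5 = -s := by ring
  rw [heq] at haux
  have heq2 : -(s + 3 / 5) = -s - 3 / 5 := by ring
  rw [heq2] at hA
  set aA := volume ({y : E3 | ∀ ν : E3, ⟪y, ν⟫_ℝ ≤ Real.sqrt 2 / 4 *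
        ∑ᶠ w ∈ {w | w ∈ fccStacking 1 (Real.sqrt (2 / 3)) ∧ ‖w‖ = 1}, |⟪w, A.symm ν⟫_ℝ|} ∩
        {y : E3 | s + 3 / 5 < ⟪y, n⟫_ℝ}) with haA
  set aA' := volume ({y : E3 | ∀ ν : E3, ⟪y, ν⟫_ℝ ≤ Real.sqrt 2 / 4 *
        ∑ᶠ w ∈ {w | w ∈ fccStacking 1 (Real.sqrt (2 / 3)) ∧ ‖w‖ = 1}, |⟪w, A.symm ν⟫_ℝ|} ∩
        {y : E3 | -s - 3 / 5 < ⟪y, n⟫_ℝ}) with haA'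
  set aB := volume ({y : E3 | ∀ ν : E3, ⟪y, ν⟫_ℝ ≤ Real.sqrt 2 / 4 *
        ∑ᶠ w ∈ {w | w ∈ fccStacking 1 (Real.sqrt (2 / 3)) ∧ ‖w‖ = 1}, |⟪w, B.symm ν⟫_ℝ|} ∩
        {y : E3 | s < ⟪y, n⟫_ℝ}) with haB
  set aB' := volume ({y : E3 | ∀ ν : E3, ⟪y, ν⟫_ℝ ≤ Real.sqrt 2 / 4 *
        ∑ᶠ w ∈ {w | w ∈ fccStacking 1 (Real.sqrt (2 / 3)) ∧ ‖w‖ = 1}, |⟪w, B.symm ν⟫_ℝ|} ∩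
        {y : E3 | -s < ⟪y, n⟫_ℝ}) with haB'
  have hA'top : aA' ≠ ⊤ := by
    intro ht; rw [ht, add_top] at hA; exact ENNReal.ofReal_ne_top hA.symm
  have hB'top : aB' ≠ ⊤ := by
    intro ht; rw [ht, add_top] at hB; exact ENNReal.ofReal_ne_top hB.symm
  have h1 : aA = ENNReal.ofReal 32 - aA' := ENNReal.eq_sub_of_add_eq hA'top hA
  have h2 : aB = ENNReal.ofReal 32 - aB' := ENNReal.eq_sub_of_add_eq hB'top hB
  rw [h1, h2]
  exact tsub_le_tsub_left haux _

end Summit.Ventures.Crystal3D.Theorems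

end
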